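import Summits.QuantumFields.YangMills.Theorems.BalabanUVNodesN15KingModelGaussianMoments

/-!
# BalabanUVNodes ∕ N15 — THE KING-MODEL RUNG (PART Ϝ-t): WICK's THEOREM FOR FOUR FIELDS UNDER THE GAUSSIAN LAW `ρ_A dx` —
# `∫⟨J₁,x⟩⟨J₂,x⟩⟨J₃,x⟩⟨J₄,x⟩ρ_A = B₁₂B₃₄ + B₁₃B₂₄ + B₁₄B₂₃`, `B_{ab} = ⟨J_a, A⁻¹J_b⟩` (degree-four polarization of part Ϝ-s's `∫⟨J,x⟩⁴ρ_A = 3⟨J,A⁻¹J⟩²`) —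
# AND THE FOUR-POINT SCHWINGER FUNCTION OF THE BLOCK AVERAGES OF THE FINE FREE FIELD: `⟨φ(w)φ(x)φ(y)φ(z)⟩_K = S₂S₂ + S₂S₂ + S₂S₂` (three pairings)
# (Track A, DAG node N15 = NE2; FAN-OUT v1.1 §N15 s3 «KING-MODEL RUNG»; uses parts Ϝ-d, Ϝ-r, Ϝ-s; count-neutral)

HONEST FRAMING.  Count-neutral (cell `pub-ymgap`, seat `pub-ymgap-dag-n15-e` g33; `--supports stmt-QuantumFields-27366 --as helper` = K3⁸
`SpineGivenEndpointR13SepCoPHV`).  Folklore (Isserlis 1918 ∕ Wick 1950) for the DENSITY-defined centred Gaussian law `ρ_A(x)dx = e^{−½⟨x,Ax⟩}dx∕𝒩(A)`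
of a symmetric coercive precision `A` on `ℝ^ι` — the shape of every measure of [King1986] (C. King, Commun. Math. Phys. **102** (1986) 649–677),
(2.6) p.652: the pointwise polarization identity `192·s₁s₂s₃s₄ = Σ_{ε₂,ε₃,ε₄ = ±1} ε₂ε₃ε₄(s₁+ε₂s₂+ε₃s₃+ε₄s₄)⁴` (`ring`) turns the four-field moment
into eight fourth line-moments of part Ϝ-s (`integral_dot_pow_four_gaussDensity`), and the collapse `Σ ε₂ε₃ε₄·3B(J_ε,J_ε)² = 192(B₁₂B₃₄+B₁₃B₂₄+B₁₄B₂₃)`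
is again `ring` after bilinear expansion and the symmetry of `A⁻¹`.  The tree's `B3WTFreeMeasure.integral_linF_mul₄` is the same statement for the
KOLMOGOROV-built `gaussianFieldOfKernel`; this file is its counterpart for the density-defined law used by parts Τ∕Ϡ∕Ϝ (no identification of the two is
claimed).  KING APPLICATION (`A = 0`, `g = 0` free covariance model; unit torus `𝕋_M`, fine torus `T_{1∕N}`, `N = L^K`): with part Ϝ-r's precision
`P_K = (S₂^{(K)})⁻¹`, ★★★ `∫ φ(w)φ(x)φ(y)φ(z) ρ_{P_K}(φ)dφ = S₂^{(K)}(w,x)S₂^{(K)}(y,z) + S₂^{(K)}(w,y)S₂^{(K)}(x,z) + S₂^{(K)}(w,z)S₂^{(K)}(x,y)` — the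
four-point Schwinger function of the block-averaged free field is the sum over the three pairings of part Ϝ-d's two-point function — its `K = ∞` twin
with `S₂^{(∞)}`, and the convergence of all fourth moments as `K → ∞`.  Nothing Bałaban ∕ continuum-Yang–Mills ∕ `ℝ⁴` ∕ OS ∕ mass-gap ∕ Clay; N15 is
booked through n15-a's knit, untouched here.  0 `sorry`, 0 def; standard axioms.

WHAT THIS FILE PROVES (kernel).  `prod_four_eq_polar` (the polarization identity), `integrable_dot_pow_four_gaussDensity`, ★★★ **`integral_dot_mul_four_gaussDensity`**
(Wick for four linear functionals), ★★ `integral_eval_mul_four_gaussDensity` (`∫x_ix_jx_kx_lρ_A = (A⁻¹)_{ij}(A⁻¹)_{kl} + (A⁻¹)_{ik}(A⁻¹)_{jl} + (A⁻¹)_{il}(A⁻¹)_{jk}`),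
`integral_eval_sq_mul_sq_gaussDensity`, `integral_eval_pow_four_gaussDensity`; KING: ★★★ **`integral_eval_mul_four_fineBlockLaw`**, ★★★ `integral_eval_mul_four_fineBlockLawLim`,
★★ `tendsto_integral_eval_mul_four_fineBlockLaw`.
-/

noncomputable section

open scoped BigOperators
open Finset Matrix Filter Topology MeasureTheory

namespace Summit.QuantumFields.YangMills.BalabanUVNodes.N15KingModelRung.FreeField

open Literature.MathematicalPhysics.QuantumFieldTheory.Balaban1983to89.QGQInverse (Coercive isUnit_of_coercive)

variable {ι : Type*} [Fintype ι] [DecidableEq ι]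

/-! ## §1 Degree-four polarization -/

/-- **Polarization of the fourth power**: `192·s₁s₂s₃s₄ = Σ_{ε₂,ε₃,ε₄ = ±1} ε₂ε₃ε₄ (s₁ + ε₂s₂ + ε₃s₃ + ε₄s₄)⁴`. [folklore] -/
theorem prod_four_eq_polar (s₁ s₂ s₃ s₄ : ℝ) :
    s₁ * s₂ * s₃ * s₄ = (1 / 192 : ℝ) * (s₁ + s₂ + s₃ + s₄) ^ 4 - (1 / 192 : ℝ) * (s₁ - s₂ + s₃ + s₄) ^ 4
      - (1 / 192 : ℝ) * (s₁ + s₂ - s₃ + s₄) ^ 4 - (1 / 192 : ℝ) * (s₁ + s₂ + s₃ - s₄) ^ 4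
      + (1 / 192 : ℝ) * (s₁ - s₂ - s₃ + s₄) ^ 4 + (1 / 192 : ℝ) * (s₁ - s₂ + s₃ - s₄) ^ 4
      + (1 / 192 : ℝ) * (s₁ + s₂ - s₃ - s₄) ^ 4 - (1 / 192 : ℝ) * (s₁ - s₂ - s₃ - s₄) ^ 4 := by
  ring

section Wick

variable {A : Matrix ι ι ℝ} {δ : ℝ}

omit [DecidableEq ι] in
/-- `⟨J,x⟩⁴ρ_A` is integrable (part Ϝ-s at `t = 0`). [folklore] -/
theorem integrable_dot_pow_four_gaussDensity (hδ : 0 < δ) (hA : Coercive A δ) (J : ι → ℝ) :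
    Integrable fun x : ι → ℝ => (J ⬝ᵥ x) ^ 4 * gaussDensity A x := by
  refine (integrable_pow_mul_exp_mul_gaussDensity hδ hA J 4 0).congr (Eventually.of_forall fun x => ?_)
  simp only [zero_mul, Real.exp_zero, mul_one]

/-- ★★★ **WICK's THEOREM FOR FOUR LINEAR FUNCTIONALS** under `ρ_A dx` (`A` symmetric coercive):
`∫⟨J₁,x⟩⟨J₂,x⟩⟨J₃,x⟩⟨J₄,x⟩ρ_A(x)dx = B₁₂B₃₄ + B₁₃B₂₄ + B₁₄B₂₃`, `B_{ab} = ⟨J_a, A⁻¹J_b⟩` (three pairings). [folklore] -/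
theorem integral_dot_mul_four_gaussDensity (hδ : 0 < δ) (hA : Coercive A δ) (hsymm : Aᵀ = A) (J₁ J₂ J₃ J₄ : ι → ℝ) :
    ∫ x : ι → ℝ, (J₁ ⬝ᵥ x) * (J₂ ⬝ᵥ x) * (J₃ ⬝ᵥ x) * (J₄ ⬝ᵥ x) * gaussDensity A x
      = (J₁ ⬝ᵥ (A⁻¹ *ᵥ J₂)) * (J₃ ⬝ᵥ (A⁻¹ *ᵥ J₄)) + (J₁ ⬝ᵥ (A⁻¹ *ᵥ J₃)) * (J₂ ⬝ᵥ (A⁻¹ *ᵥ J₄))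
        + (J₁ ⬝ᵥ (A⁻¹ *ᵥ J₄)) * (J₂ ⬝ᵥ (A⁻¹ *ᵥ J₃)) := by
  have I : ∀ K : ι → ℝ, ∫ x : ι → ℝ, (K ⬝ᵥ x) ^ 4 * gaussDensity A x = 3 * (K ⬝ᵥ (A⁻¹ *ᵥ K)) ^ 2 :=
    fun K => integral_dot_pow_four_gaussDensity hδ hA hsymm K
  have h : ∀ K : ι → ℝ, Integrable fun x : ι → ℝ => (1 / 192 : ℝ) * ((K ⬝ᵥ x) ^ 4 * gaussDensity A x) :=
    fun K => (integrable_dot_pow_four_gaussDensity hδ hA K).const_mul _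
  -- pointwise polarization of the integrand
  have e : ∀ x : ι → ℝ, (J₁ ⬝ᵥ x) * (J₂ ⬝ᵥ x) * (J₃ ⬝ᵥ x) * (J₄ ⬝ᵥ x) * gaussDensity A x
      = (1 / 192 : ℝ) * (((J₁ + J₂ + J₃ + J₄) ⬝ᵥ x) ^ 4 * gaussDensity A x)
        - (1 / 192 : ℝ) * (((J₁ - J₂ + J₃ + J₄) ⬝ᵥ x) ^ 4 * gaussDensity A x)
        - (1 / 192 : ℝ) * (((J₁ + J₂ - J₃ + J₄) ⬝ᵥ x) ^ 4 * gaussDensity A x)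
        - (1 / 192 : ℝ) * (((J₁ + J₂ + J₃ - J₄) ⬝ᵥ x) ^ 4 * gaussDensity A x)
        + (1 / 192 : ℝ) * (((J₁ - J₂ - J₃ + J₄) ⬝ᵥ x) ^ 4 * gaussDensity A x)
        + (1 / 192 : ℝ) * (((J₁ - J₂ + J₃ - J₄) ⬝ᵥ x) ^ 4 * gaussDensity A x)
        + (1 / 192 : ℝ) * (((J₁ + J₂ - J₃ - J₄) ⬝ᵥ x) ^ 4 * gaussDensity A x)
        - (1 / 192 : ℝ) * (((J₁ - J₂ - J₃ - J₄) ⬝ᵥ x) ^ 4 * gaussDensity A x) := by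
    intro x
    simp only [add_dotProduct, sub_dotProduct]
    ring
  simp_rw [e]
  -- the partial sums are integrable (for splitting the integral)
  have P2 := (h (J₁ + J₂ + J₃ + J₄)).sub (h (J₁ - J₂ + J₃ + J₄))
  have P3 := P2.sub (h (J₁ + J₂ - J₃ + J₄))
  have P4 := P3.sub (h (J₁ + J₂ + J₃ - J₄))
  have P5 := P4.add (h (J₁ - J₂ - J₃ + J₄))
  have P6 := P5.add (h (J₁ - J₂ + J₃ - J₄))
  have P7 := P6.add (h (J₁ + J₂ - J₃ - J₄))
  rw [integral_sub, integral_add, integral_add, integral_add, integral_sub, integral_sub, integral_sub]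
  · simp only [integral_const_mul, I]
    simp only [add_dotProduct, sub_dotProduct, Matrix.mulVec_add, Matrix.mulVec_sub, dotProduct_add, dotProduct_sub]
    have hS := transpose_inv_of_transpose_eq hsymm
    rw [dot_mulVec_comm_of_transpose_eq hS J₂ J₁, dot_mulVec_comm_of_transpose_eq hS J₃ J₁, dot_mulVec_comm_of_transpose_eq hS J₄ J₁,
      dot_mulVec_comm_of_transpose_eq hS J₃ J₂, dot_mulVec_comm_of_transpose_eq hS J₄ J₂, dot_mulVec_comm_of_transpose_eq hS J₄ J₃]
    ring
  all_goals first
    | exact h _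
    | exact P2
    | exact P3
    | exact P4
    | exact P5
    | exact P6
    | exact P7

/-- ★★ **ENTRYWISE WICK**: `∫ x_i x_j x_k x_l ρ_A(x)dx = (A⁻¹)_{ij}(A⁻¹)_{kl} + (A⁻¹)_{ik}(A⁻¹)_{jl} + (A⁻¹)_{il}(A⁻¹)_{jk}`. [folklore] -/
theorem integral_eval_mul_four_gaussDensity (hδ : 0 < δ) (hA : Coercive A δ) (hsymm : Aᵀ = A) (i j k l : ι) :
    ∫ x : ι → ℝ, x i * x j * x k * x l * gaussDensity A x = A⁻¹ i j * A⁻¹ k l + A⁻¹ i k * A⁻¹ j l + A⁻¹ i l * A⁻¹ j k := by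
  have h := integral_dot_mul_four_gaussDensity hδ hA hsymm (Pi.single i 1) (Pi.single j 1) (Pi.single k 1) (Pi.single l 1)
  simp_rw [single_one_dotProduct, Matrix.mulVec_single_one] at h
  exact h

/-- `∫ x_i² x_j² ρ_A = (A⁻¹)_{ii}(A⁻¹)_{jj} + 2(A⁻¹)_{ij}²`. [folklore] -/
theorem integral_eval_sq_mul_sq_gaussDensity (hδ : 0 < δ) (hA : Coercive A δ) (hsymm : Aᵀ = A) (i j : ι) :
    ∫ x : ι → ℝ, x i ^ 2 * x j ^ 2 * gaussDensity A x = A⁻¹ i i * A⁻¹ j j + 2 * A⁻¹ i j ^ 2 := by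
  have h := integral_eval_mul_four_gaussDensity hδ hA hsymm i i j j
  have e : ∀ x : ι → ℝ, x i ^ 2 * x j ^ 2 * gaussDensity A x = x i * x i * x j * x j * gaussDensity A x := fun x => by ring
  simp_rw [e]
  rw [h]
  ring

/-- `∫ x_i⁴ ρ_A = 3(A⁻¹)_{ii}²`. [folklore] -/
theorem integral_eval_pow_four_gaussDensity (hδ : 0 < δ) (hA : Coercive A δ) (hsymm : Aᵀ = A) (i : ι) :
    ∫ x : ι → ℝ, x i ^ 4 * gaussDensity A x = 3 * A⁻¹ i i ^ 2 := by
  have h := integral_dot_pow_four_gaussDensity hδ hA hsymm (Pi.single i 1)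
  simp_rw [single_one_dotProduct, Matrix.mulVec_single_one] at h
  exact h

end Wick

end Summit.QuantumFields.YangMills.BalabanUVNodes.N15KingModelRung.FreeField

/-! ## §2 KING: the four-point Schwinger function of the block averages of the fine free field -/

namespace Summit.QuantumFields.YangMills.BalabanUVNodes.N15KingModelRung

open Literature.MathematicalPhysics.QuantumFieldTheory.Balaban1983to89.B5Prop11Plancherel (Tor)
open Literature.MathematicalPhysics.QuantumFieldTheory.Balaban1983to89.QGQInverse (Coercive isUnit_of_coercive)
open FreeField

section King

variable {d : ℕ} (L : ℕ) (M : Fin (d + 1) → ℕ) [hM : ∀ ν, NeZero (M ν)]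

/-- ★★★ **THE FOUR-POINT SCHWINGER FUNCTION OF THE BLOCK-AVERAGED FREE FIELD IS THE SUM OVER THE THREE PAIRINGS**:
`∫ φ(w)φ(x)φ(y)φ(z) ρ_{P_K}(φ)dφ = S₂^{(K)}(w,x)S₂^{(K)}(y,z) + S₂^{(K)}(w,y)S₂^{(K)}(x,z) + S₂^{(K)}(w,z)S₂^{(K)}(x,y)`, `P_K = (S₂^{(K)})⁻¹` (`A = 0`, `g = 0`).
[cite: King1986, (2.6) p.652, (2.13) p.653, Thm 2.1 (2.23) p.654] -/
theorem integral_eval_mul_four_fineBlockLaw (N : ℕ) [NeZero N] {m2 : ℝ} (hm : 0 < m2) (w x y z : Tor M) :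
    ∫ φ : Tor M → ℝ, φ w * φ x * φ y * φ z * gaussDensity (fineBlockPrec M N m2) φ
      = kingS2 N M m2 w x * kingS2 N M m2 y z + kingS2 N M m2 w y * kingS2 N M m2 x z + kingS2 N M m2 w z * kingS2 N M m2 x y := by
  rw [integral_eval_mul_four_gaussDensity hm (coercive_fineBlockPrec M N hm) (fineBlockPrec_transpose M N m2), fineBlockPrec_inv M N hm]
  simp only [Matrix.of_apply]

/-- ★★★ **THE `K = ∞` TWIN** with `S₂^{(∞)}`. [cite: King1986, (2.6) p.652, Thm 2.1 (2.23) p.654] -/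
theorem integral_eval_mul_four_fineBlockLawLim (hLodd : Odd L) (hL : 2 ≤ L) {m2 : ℝ} (hm : 0 < m2) (w x y z : Tor M) :
    ∫ φ : Tor M → ℝ, φ w * φ x * φ y * φ z * gaussDensity (fineBlockPrecLim M m2) φ
      = kingS2Lim M m2 w x * kingS2Lim M m2 y z + kingS2Lim M m2 w y * kingS2Lim M m2 x z + kingS2Lim M m2 w z * kingS2Lim M m2 x y := by
  rw [integral_eval_mul_four_gaussDensity hm (coercive_fineBlockPrecLim L M hLodd hL hm) (fineBlockPrecLim_transpose M m2),
    fineBlockPrecLim_inv L M hLodd hL hm]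
  simp only [Matrix.of_apply]

/-- ★★ **ALL FOURTH MOMENTS CONVERGE** (`K → ∞`; unbounded observables, by the closed forms and part Ϝ-d's `tendsto_kingS2`).
[cite: King1986, Thm 2.1 (2.23) p.654] -/
theorem tendsto_integral_eval_mul_four_fineBlockLaw (hLodd : Odd L) (hL : 2 ≤ L) {m2 : ℝ} (hm : 0 < m2) (w x y z : Tor M) :
    haveI : NeZero L := ⟨by omega⟩
    Tendsto (fun K : ℕ => ∫ φ : Tor M → ℝ, φ w * φ x * φ y * φ z * gaussDensity (fineBlockPrec M (L ^ K) m2) φ) atTop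
      (𝓝 (∫ φ : Tor M → ℝ, φ w * φ x * φ y * φ z * gaussDensity (fineBlockPrecLim M m2) φ)) := by
  haveI : NeZero L := ⟨by omega⟩
  have e : (fun K : ℕ => ∫ φ : Tor M → ℝ, φ w * φ x * φ y * φ z * gaussDensity (fineBlockPrec M (L ^ K) m2) φ)
      = fun K => kingS2 (L ^ K) M m2 w x * kingS2 (L ^ K) M m2 y z + kingS2 (L ^ K) M m2 w y * kingS2 (L ^ K) M m2 x z
          + kingS2 (L ^ K) M m2 w z * kingS2 (L ^ K) M m2 x y :=
    funext fun K => integral_eval_mul_four_fineBlockLaw M (L ^ K) hm w x y z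
  rw [e, integral_eval_mul_four_fineBlockLawLim L M hLodd hL hm w x y z]
  have t := tendsto_kingS2 L M hLodd hL hm
  exact (((t w x).mul (t y z)).add ((t w y).mul (t x z))).add ((t w z).mul (t x y))

end King

end Summit.QuantumFields.YangMills.BalabanUVNodes.N15KingModelRung

end
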